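import Summits.Ventures.QEC.Census.BB.BB784RankXc
import Summits.Ventures.QEC.Census.BB.BB784RankZc
import Summits.Ventures.QEC.Census.BB.BB784Bound
import Literature.InformationTheory.QuantumCodes.CSSParameters
import HarnessLib

/-!
# `[[784,24,≤24]]`: the printed row of Bravyi et al. §5 is a kernel theorem AS PRINTED — `k (BB.bb784) = 24` and `d (BB.bb784) ≤ 24`

`BB.bb784` = `QC(x²⁶+y⁶+y⁸, y⁷+x⁹+x²⁰)` on `ℤ₂₈ × ℤ₁₄` [BravyiEtAl2024, §5] (arXiv:2308.07915 chunk p0011 L41–47: "which has parameters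
`[[784,24,≤24]]`"), typed in `Literature/InformationTheory/QuantumCodes/BivariateBicycleCodesSection5.lean`. This file assembles the
upper-bound row in the sense of `Census/BB/ClaimsUB.lean`: **`k = 784 − 380 − 380 = 24`** (= the printed `k`) from the two CHUNKED
masks-only RREF rank theorems `rank_HXFlat` / `rank_HZFlat` (`Census/BB/BB784RankXc.lean`, `BB784RankZc.lean`: reduced rows re-derived
chunk-wise, unit pivot columns over index ranges, row re-assembly — `Census/RankRREFAppend.lean`, `Census/RankPivotChunks.lean`) via
`CSSCode.k_eq` / `BB.Code.cssFlat_k`, and `d ≤ 24` from `Census/BB/BB784Bound.lean` (`dZ_le`: kernel-checked weight-24 `Z`-logical);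
assembled **`BB784_24_le24_holds : BB.HasParamsUB BB.bb784 784 24 24`** (`BB.hasParamsUB_of_dZ_le`). Tier KERNEL; axioms standard;
no `native_decide`. HONEST FRAMING: an UPPER-BOUND row reproducing the printed `k` and the printed bound `≤ 24` for the typed object;
NO distance word (the paper itself prints only an upper bound).
-/

namespace Summit.Ventures.QEC.Census.BB784

open Matrix Literature.InformationTheory.QuantumCodes BBRows

set_option maxHeartbeats 2000000 in -- large index types met by the rewrite
set_option maxRecDepth 200000 in
/-- **`k (BB.bb784) = 24`** = the printed `k`: `k = n − rank₂ H^X − rank₂ H^Z = 784 − 380 − 380` (CERTIFIED, kernel tier). -/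
theorem obj_k : BB.bb784.k = 24 := by
  rw [← BB.bb784.cssFlat_k, CSSCode.k_eq, Fintype.card_fin, BB.Code.cssFlat_HX, BB.Code.cssFlat_HZ, rank_HXFlat,
    rank_HZFlat]

/-- **`[[784, 24, ≤24]]`** AS PRINTED — `n = 784`, `k = 24`, `d ≤ 24` for the typed `BB.bb784` (`BB.HasParamsUB`; kernel tier). -/
theorem BB784_24_le24_holds : Summit.Ventures.QEC.BB.HasParamsUB BB.bb784 784 24 24 :=
  Summit.Ventures.QEC.BB.hasParamsUB_of_dZ_le numQubits_obj obj_k dZ_le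

end Summit.Ventures.QEC.Census.BB784
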